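import Summits.Ventures.PercRepro.HyperplaneKeyBases
import Summits.Ventures.PercRepro.HyperplaneKeySeven

/-!
# PercRepro — THE HYPERPLANE KEY AT LEVEL `7`, SHARPENED: THE ROWS `10 … 21` FROM `n ≥ 182 … 196` (p1, gen 43; S4 feeder —
p9 owns SUBCLAIM-S4; no window claim here)

The flat-by-flat count of `HyperplaneKeyBases` with the `e`-free flat bounds `f(0 … 7) = 0, 1, 3, 6, 10, 19, 39, 79`
(`flat_seven_of_free`) gives the weights `g = 1, 2, 4, 8, 32, 99, 387624, 538123198718864` (`flat_seven_weights`: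
`j!·2^s ≤ g_j·∏_{i<j} max(s − f_i, 1)` for every `j ≤ s ≤ f_j`, a finite check; `5040·2^79/(79·78·76·73·69·60·40) =
5.381…·10^14`) in place of `2^{f_j − j}` (`2^72` at `j = 7`), so **`RLS M p 7` for every `e`-free `M` of rank `p` on `n ≥ n₀(p)`
points, `n₀ = 182 / 184 / 186 / 186 / 188 / 188 / 190 / 192 / 192 / 194 / 194 / 196` at `p = 10 … 21`** (the cells `(p, d)` with
`d ≥ 172 … 175`; `HyperplaneKeySeven`: `234 … 248`, `d ≥ 224 … 227`). Coloops are not excluded. Nothing is claimed about any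
cell below these coranks.

* `flat_seven_weights` — the finite check (the weights `g` and the bounds `f` are written out as functions);
  `ncard_eRk_le_seven_le_of_free_flats` — the count; `c025_core_seven_hyperplane_key_sharp_<p>` — the rows.
Axioms: standard.
-/

open scoped Matroid

namespace PercRepro

namespace HypKey

open Set

variable {α : Type}

/-- `flat_seven_of_free` with the bounds as one function `f = 0, 1, 3, 6, 10, 19, 39, 79`. -/
theorem flat_seven_of_free' (M : Matroid α) [M.Finite]
    (hfree : ∀ e ∈ M.E, ∃ A ⊆ M.E \ {e}, e ∉ M.closure A ∧ e ∉ M.closure ((M.E \ {e}) \ A)) :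
    ∀ j : ℕ, j ≤ 7 → ∀ X ⊆ M.E, M.eRk X ≤ (j : ℕ∞) → X.ncard ≤ (fun j : ℕ => if j ≤ 2 then 2 ^ j - 1 else if j = 3 then 6 else if j = 4 then 10 else if j = 5 then 19 else if j = 6 then 39 else 79) j :=
  flat_seven_of_free M hfree

set_option maxHeartbeats 1600000 in
/-- The finite check at `j = 7`, `7 ≤ s ≤ 43`. -/
theorem flat_seven_weights_seven_a : ∀ s, 7 ≤ s → s ≤ 43 →
    Nat.factorial 7 * 2 ^ s ≤ (fun j : ℕ => if j = 0 then 1 else if j = 1 then 2 else if j = 2 then 4 else if j = 3 then 8 else if j = 4 then 32 else if j = 5 then 99 else if j = 6 then 387624 else 538123198718864) 7 * ∏ i ∈ Finset.range 7, max (s - (fun j : ℕ => if j ≤ 2 then 2 ^ j - 1 else if j = 3 then 6 else if j = 4 then 10 else if j = 5 then 19 else if j = 6 then 39 else 79) i) 1 := by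
  intro s h1 h2
  interval_cases s <;> decide

set_option maxHeartbeats 1600000 in
/-- The finite check at `j = 7`, `44 ≤ s ≤ 79` (the ratio peaks at `s = 79`). -/
theorem flat_seven_weights_seven_b : ∀ s, 44 ≤ s → s ≤ 79 →
    Nat.factorial 7 * 2 ^ s ≤ (fun j : ℕ => if j = 0 then 1 else if j = 1 then 2 else if j = 2 then 4 else if j = 3 then 8 else if j = 4 then 32 else if j = 5 then 99 else if j = 6 then 387624 else 538123198718864) 7 * ∏ i ∈ Finset.range 7, max (s - (fun j : ℕ => if j ≤ 2 then 2 ^ j - 1 else if j = 3 then 6 else if j = 4 then 10 else if j = 5 then 19 else if j = 6 then 39 else 79) i) 1 := by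
  intro s h1 h2
  interval_cases s <;> decide

set_option maxHeartbeats 1600000 in
/-- The finite check at `j = 6`, `6 ≤ s ≤ 39`. -/
theorem flat_seven_weights_six : ∀ s, 6 ≤ s → s ≤ 39 →
    Nat.factorial 6 * 2 ^ s ≤ (fun j : ℕ => if j = 0 then 1 else if j = 1 then 2 else if j = 2 then 4 else if j = 3 then 8 else if j = 4 then 32 else if j = 5 then 99 else if j = 6 then 387624 else 538123198718864) 6 * ∏ i ∈ Finset.range 6, max (s - (fun j : ℕ => if j ≤ 2 then 2 ^ j - 1 else if j = 3 then 6 else if j = 4 then 10 else if j = 5 then 19 else if j = 6 then 39 else 79) i) 1 := by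
  intro s h1 h2
  interval_cases s <;> decide

set_option maxHeartbeats 1600000 in
/-- The finite check at `j = 5`, `5 ≤ s ≤ 19`. -/
theorem flat_seven_weights_five : ∀ s, 5 ≤ s → s ≤ 19 →
    Nat.factorial 5 * 2 ^ s ≤ (fun j : ℕ => if j = 0 then 1 else if j = 1 then 2 else if j = 2 then 4 else if j = 3 then 8 else if j = 4 then 32 else if j = 5 then 99 else if j = 6 then 387624 else 538123198718864) 5 * ∏ i ∈ Finset.range 5, max (s - (fun j : ℕ => if j ≤ 2 then 2 ^ j - 1 else if j = 3 then 6 else if j = 4 then 10 else if j = 5 then 19 else if j = 6 then 39 else 79) i) 1 := by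
  intro s h1 h2
  interval_cases s <;> decide

/-- The finite check at `j = 4`, `4 ≤ s ≤ 10`. -/
theorem flat_seven_weights_four : ∀ s, 4 ≤ s → s ≤ 10 →
    Nat.factorial 4 * 2 ^ s ≤ (fun j : ℕ => if j = 0 then 1 else if j = 1 then 2 else if j = 2 then 4 else if j = 3 then 8 else if j = 4 then 32 else if j = 5 then 99 else if j = 6 then 387624 else 538123198718864) 4 * ∏ i ∈ Finset.range 4, max (s - (fun j : ℕ => if j ≤ 2 then 2 ^ j - 1 else if j = 3 then 6 else if j = 4 then 10 else if j = 5 then 19 else if j = 6 then 39 else 79) i) 1 := by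
  intro s h1 h2
  interval_cases s <;> decide

/-- The finite check at `j = 3`, `3 ≤ s ≤ 6`. -/
theorem flat_seven_weights_three : ∀ s, 3 ≤ s → s ≤ 6 →
    Nat.factorial 3 * 2 ^ s ≤ (fun j : ℕ => if j = 0 then 1 else if j = 1 then 2 else if j = 2 then 4 else if j = 3 then 8 else if j = 4 then 32 else if j = 5 then 99 else if j = 6 then 387624 else 538123198718864) 3 * ∏ i ∈ Finset.range 3, max (s - (fun j : ℕ => if j ≤ 2 then 2 ^ j - 1 else if j = 3 then 6 else if j = 4 then 10 else if j = 5 then 19 else if j = 6 then 39 else 79) i) 1 := by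
  intro s h1 h2
  interval_cases s <;> decide

/-- The finite check at `j ≤ 2`. -/
theorem flat_seven_weights_low : ∀ j ≤ 2, ∀ s, j ≤ s → s ≤ (fun j : ℕ => if j ≤ 2 then 2 ^ j - 1 else if j = 3 then 6 else if j = 4 then 10 else if j = 5 then 19 else if j = 6 then 39 else 79) j →
    j.factorial * 2 ^ s ≤ (fun j : ℕ => if j = 0 then 1 else if j = 1 then 2 else if j = 2 then 4 else if j = 3 then 8 else if j = 4 then 32 else if j = 5 then 99 else if j = 6 then 387624 else 538123198718864) j * ∏ i ∈ Finset.range j, max (s - (fun j : ℕ => if j ≤ 2 then 2 ^ j - 1 else if j = 3 then 6 else if j = 4 then 10 else if j = 5 then 19 else if j = 6 then 39 else 79) i) 1 := by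
  intro j hj s hjs hs
  have hs' : s ≤ 3 := le_trans hs (by interval_cases j <;> decide)
  interval_cases j <;> interval_cases s <;> first | decide | (exfalso; revert hs; decide)

/-- **THE FINITE CHECK**: `j!·2^s ≤ g_j · ∏_{i<j} max(s − f_i, 1)` for every `j ≤ 7` and `j ≤ s ≤ f_j`. -/
theorem flat_seven_weights : ∀ j ≤ 7, ∀ s, j ≤ s → s ≤ (fun j : ℕ => if j ≤ 2 then 2 ^ j - 1 else if j = 3 then 6 else if j = 4 then 10 else if j = 5 then 19 else if j = 6 then 39 else 79) j →
    j.factorial * 2 ^ s ≤ (fun j : ℕ => if j = 0 then 1 else if j = 1 then 2 else if j = 2 then 4 else if j = 3 then 8 else if j = 4 then 32 else if j = 5 then 99 else if j = 6 then 387624 else 538123198718864) j * ∏ i ∈ Finset.range j, max (s - (fun j : ℕ => if j ≤ 2 then 2 ^ j - 1 else if j = 3 then 6 else if j = 4 then 10 else if j = 5 then 19 else if j = 6 then 39 else 79) i) 1 := by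
  intro j hj s hjs hs
  rcases Nat.lt_or_ge j 3 with h3 | h3
  · exact flat_seven_weights_low j (by omega) s hjs hs
  · interval_cases j
    · exact flat_seven_weights_three s hjs (by simpa using hs)
    · exact flat_seven_weights_four s hjs (by simpa using hs)
    · exact flat_seven_weights_five s hjs (by simpa using hs)
    · exact flat_seven_weights_six s hjs (by simpa using hs)
    · rcases Nat.lt_or_ge s 44 with h44 | h44
      · exact flat_seven_weights_seven_a s hjs (by omega)
      · exact flat_seven_weights_seven_b s h44 (by simpa using hs)

/-- **THE RANK-`≤ 7` COUNT OF AN `e`-FREE MATROID, FLAT BY FLAT**: `#{ρ ≤ 7} ≤ Σ_{j ≤ 7} C(n, j)·g_j`. -/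
theorem ncard_eRk_le_seven_le_of_free_flats (M : Matroid α) [M.Finite]
    (hfree : ∀ e ∈ M.E, ∃ A ⊆ M.E \ {e}, e ∉ M.closure A ∧ e ∉ M.closure ((M.E \ {e}) \ A)) :
    {X : Set α | X ⊆ M.E ∧ M.eRk X ≤ ((7 : ℕ) : ℕ∞)}.ncard ≤
      ∑ j ∈ Finset.range (7 + 1), M.E.ncard.choose j * (fun j : ℕ => if j = 0 then 1 else if j = 1 then 2 else if j = 2 then 4 else if j = 3 then 8 else if j = 4 then 32 else if j = 5 then 99 else if j = 6 then 387624 else 538123198718864) j :=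
  ncard_eRk_le_le_sum_choose_flats M 7 (fun j : ℕ => if j ≤ 2 then 2 ^ j - 1 else if j = 3 then 6 else if j = 4 then 10 else if j = 5 then 19 else if j = 6 then 39 else 79) (fun j : ℕ => if j = 0 then 1 else if j = 1 then 2 else if j = 2 then 4 else if j = 3 then 8 else if j = 4 then 32 else if j = 5 then 99 else if j = 6 then 387624 else 538123198718864) (flat_seven_of_free' M hfree) flat_seven_weights

/-- **The row `p = 10` at level `7` from `n = 182` on** (`d ≥ 172`; `HyperplaneKeySeven`: from `n = 234`, `d ≥ 224`). -/
theorem c025_core_seven_hyperplane_key_sharp_ten (M : Matroid α) [M.Finite] (hR : M.eRank = ((10 : ℕ) : ℕ∞))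
    (hn : 182 ≤ M.E.ncard)
    (hfree : ∀ e ∈ M.E, ∃ A ⊆ M.E \ {e}, e ∉ M.closure A ∧ e ∉ M.closure ((M.E \ {e}) \ A)) :
    ThmN.RLS M 10 7 :=
  rls_of_hyperplane_key_two_base_weighted M 10 7 hR hfree (fun j : ℕ => if j = 0 then 1 else if j = 1 then 2 else if j = 2 then 4 else if j = 3 then 8 else if j = 4 then 32 else if j = 5 then 99 else if j = 6 then 387624 else 538123198718864) (ncard_eRk_le_seven_le_of_free_flats M hfree)
    182 (by norm_num) hn
    (by rw [phiK_ten_seven]; simp only [Finset.sum_range_succ, Finset.sum_range_zero]; norm_num [Nat.choose_eq_factorial_div_factorial, Nat.factorial])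
    (by rw [phiK_ten_seven]; simp only [Finset.sum_range_succ, Finset.sum_range_zero]; norm_num [Nat.choose_eq_factorial_div_factorial, Nat.factorial])

/-- **The row `p = 11` at level `7` from `n = 184` on** (`d ≥ 173`; `HyperplaneKeySeven`: from `n = 236`, `d ≥ 225`). -/
theorem c025_core_seven_hyperplane_key_sharp_eleven (M : Matroid α) [M.Finite] (hR : M.eRank = ((11 : ℕ) : ℕ∞))
    (hn : 184 ≤ M.E.ncard)
    (hfree : ∀ e ∈ M.E, ∃ A ⊆ M.E \ {e}, e ∉ M.closure A ∧ e ∉ M.closure ((M.E \ {e}) \ A)) :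
    ThmN.RLS M 11 7 :=
  rls_of_hyperplane_key_two_base_weighted M 11 7 hR hfree (fun j : ℕ => if j = 0 then 1 else if j = 1 then 2 else if j = 2 then 4 else if j = 3 then 8 else if j = 4 then 32 else if j = 5 then 99 else if j = 6 then 387624 else 538123198718864) (ncard_eRk_le_seven_le_of_free_flats M hfree)
    184 (by norm_num) hn
    (by rw [phiK_eleven_seven]; simp only [Finset.sum_range_succ, Finset.sum_range_zero]; norm_num [Nat.choose_eq_factorial_div_factorial, Nat.factorial])
    (by rw [phiK_eleven_seven]; simp only [Finset.sum_range_succ, Finset.sum_range_zero]; norm_num [Nat.choose_eq_factorial_div_factorial, Nat.factorial])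

/-- **The row `p = 12` at level `7` from `n = 186` on** (`d ≥ 174`; `HyperplaneKeySeven`: from `n = 236`, `d ≥ 224`). -/
theorem c025_core_seven_hyperplane_key_sharp_twelve (M : Matroid α) [M.Finite] (hR : M.eRank = ((12 : ℕ) : ℕ∞))
    (hn : 186 ≤ M.E.ncard)
    (hfree : ∀ e ∈ M.E, ∃ A ⊆ M.E \ {e}, e ∉ M.closure A ∧ e ∉ M.closure ((M.E \ {e}) \ A)) :
    ThmN.RLS M 12 7 :=
  rls_of_hyperplane_key_two_base_weighted M 12 7 hR hfree (fun j : ℕ => if j = 0 then 1 else if j = 1 then 2 else if j = 2 then 4 else if j = 3 then 8 else if j = 4 then 32 else if j = 5 then 99 else if j = 6 then 387624 else 538123198718864) (ncard_eRk_le_seven_le_of_free_flats M hfree)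
    186 (by norm_num) hn
    (by rw [phiK_twelve_seven]; simp only [Finset.sum_range_succ, Finset.sum_range_zero]; norm_num [Nat.choose_eq_factorial_div_factorial, Nat.factorial])
    (by rw [phiK_twelve_seven]; simp only [Finset.sum_range_succ, Finset.sum_range_zero]; norm_num [Nat.choose_eq_factorial_div_factorial, Nat.factorial])

/-- **The row `p = 13` at level `7` from `n = 186` on** (`d ≥ 173`; `HyperplaneKeySeven`: from `n = 238`, `d ≥ 225`). -/
theorem c025_core_seven_hyperplane_key_sharp_thirteen (M : Matroid α) [M.Finite] (hR : M.eRank = ((13 : ℕ) : ℕ∞))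
    (hn : 186 ≤ M.E.ncard)
    (hfree : ∀ e ∈ M.E, ∃ A ⊆ M.E \ {e}, e ∉ M.closure A ∧ e ∉ M.closure ((M.E \ {e}) \ A)) :
    ThmN.RLS M 13 7 :=
  rls_of_hyperplane_key_two_base_weighted M 13 7 hR hfree (fun j : ℕ => if j = 0 then 1 else if j = 1 then 2 else if j = 2 then 4 else if j = 3 then 8 else if j = 4 then 32 else if j = 5 then 99 else if j = 6 then 387624 else 538123198718864) (ncard_eRk_le_seven_le_of_free_flats M hfree)
    186 (by norm_num) hn
    (by rw [phiK_thirteen_seven]; simp only [Finset.sum_range_succ, Finset.sum_range_zero]; norm_num [Nat.choose_eq_factorial_div_factorial, Nat.factorial])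
    (by rw [phiK_thirteen_seven]; simp only [Finset.sum_range_succ, Finset.sum_range_zero]; norm_num [Nat.choose_eq_factorial_div_factorial, Nat.factorial])

/-- **The row `p = 14` at level `7` from `n = 188` on** (`d ≥ 174`; `HyperplaneKeySeven`: from `n = 238`, `d ≥ 224`). -/
theorem c025_core_seven_hyperplane_key_sharp_fourteen (M : Matroid α) [M.Finite] (hR : M.eRank = ((14 : ℕ) : ℕ∞))
    (hn : 188 ≤ M.E.ncard)
    (hfree : ∀ e ∈ M.E, ∃ A ⊆ M.E \ {e}, e ∉ M.closure A ∧ e ∉ M.closure ((M.E \ {e}) \ A)) :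
    ThmN.RLS M 14 7 :=
  rls_of_hyperplane_key_two_base_weighted M 14 7 hR hfree (fun j : ℕ => if j = 0 then 1 else if j = 1 then 2 else if j = 2 then 4 else if j = 3 then 8 else if j = 4 then 32 else if j = 5 then 99 else if j = 6 then 387624 else 538123198718864) (ncard_eRk_le_seven_le_of_free_flats M hfree)
    188 (by norm_num) hn
    (by rw [phiK_fourteen_seven]; simp only [Finset.sum_range_succ, Finset.sum_range_zero]; norm_num [Nat.choose_eq_factorial_div_factorial, Nat.factorial])
    (by rw [phiK_fourteen_seven]; simp only [Finset.sum_range_succ, Finset.sum_range_zero]; norm_num [Nat.choose_eq_factorial_div_factorial, Nat.factorial])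

/-- **The row `p = 15` at level `7` from `n = 188` on** (`d ≥ 173`; `HyperplaneKeySeven`: from `n = 240`, `d ≥ 225`). -/
theorem c025_core_seven_hyperplane_key_sharp_fifteen (M : Matroid α) [M.Finite] (hR : M.eRank = ((15 : ℕ) : ℕ∞))
    (hn : 188 ≤ M.E.ncard)
    (hfree : ∀ e ∈ M.E, ∃ A ⊆ M.E \ {e}, e ∉ M.closure A ∧ e ∉ M.closure ((M.E \ {e}) \ A)) :
    ThmN.RLS M 15 7 :=
  rls_of_hyperplane_key_two_base_weighted M 15 7 hR hfree (fun j : ℕ => if j = 0 then 1 else if j = 1 then 2 else if j = 2 then 4 else if j = 3 then 8 else if j = 4 then 32 else if j = 5 then 99 else if j = 6 then 387624 else 538123198718864) (ncard_eRk_le_seven_le_of_free_flats M hfree)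
    188 (by norm_num) hn
    (by rw [phiK_fifteen_seven]; simp only [Finset.sum_range_succ, Finset.sum_range_zero]; norm_num [Nat.choose_eq_factorial_div_factorial, Nat.factorial])
    (by rw [phiK_fifteen_seven]; simp only [Finset.sum_range_succ, Finset.sum_range_zero]; norm_num [Nat.choose_eq_factorial_div_factorial, Nat.factorial])

/-- **The row `p = 16` at level `7` from `n = 190` on** (`d ≥ 174`; `HyperplaneKeySeven`: from `n = 240`, `d ≥ 224`). -/
theorem c025_core_seven_hyperplane_key_sharp_sixteen (M : Matroid α) [M.Finite] (hR : M.eRank = ((16 : ℕ) : ℕ∞))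
    (hn : 190 ≤ M.E.ncard)
    (hfree : ∀ e ∈ M.E, ∃ A ⊆ M.E \ {e}, e ∉ M.closure A ∧ e ∉ M.closure ((M.E \ {e}) \ A)) :
    ThmN.RLS M 16 7 :=
  rls_of_hyperplane_key_two_base_weighted M 16 7 hR hfree (fun j : ℕ => if j = 0 then 1 else if j = 1 then 2 else if j = 2 then 4 else if j = 3 then 8 else if j = 4 then 32 else if j = 5 then 99 else if j = 6 then 387624 else 538123198718864) (ncard_eRk_le_seven_le_of_free_flats M hfree)
    190 (by norm_num) hn
    (by rw [phiK_sixteen_seven]; simp only [Finset.sum_range_succ, Finset.sum_range_zero]; norm_num [Nat.choose_eq_factorial_div_factorial, Nat.factorial])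
    (by rw [phiK_sixteen_seven]; simp only [Finset.sum_range_succ, Finset.sum_range_zero]; norm_num [Nat.choose_eq_factorial_div_factorial, Nat.factorial])

/-- **The row `p = 17` at level `7` from `n = 192` on** (`d ≥ 175`; `HyperplaneKeySeven`: from `n = 242`, `d ≥ 225`). -/
theorem c025_core_seven_hyperplane_key_sharp_seventeen (M : Matroid α) [M.Finite] (hR : M.eRank = ((17 : ℕ) : ℕ∞))
    (hn : 192 ≤ M.E.ncard)
    (hfree : ∀ e ∈ M.E, ∃ A ⊆ M.E \ {e}, e ∉ M.closure A ∧ e ∉ M.closure ((M.E \ {e}) \ A)) :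
    ThmN.RLS M 17 7 :=
  rls_of_hyperplane_key_two_base_weighted M 17 7 hR hfree (fun j : ℕ => if j = 0 then 1 else if j = 1 then 2 else if j = 2 then 4 else if j = 3 then 8 else if j = 4 then 32 else if j = 5 then 99 else if j = 6 then 387624 else 538123198718864) (ncard_eRk_le_seven_le_of_free_flats M hfree)
    192 (by norm_num) hn
    (by rw [phiK_seventeen_seven]; simp only [Finset.sum_range_succ, Finset.sum_range_zero]; norm_num [Nat.choose_eq_factorial_div_factorial, Nat.factorial])
    (by rw [phiK_seventeen_seven]; simp only [Finset.sum_range_succ, Finset.sum_range_zero]; norm_num [Nat.choose_eq_factorial_div_factorial, Nat.factorial])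

/-- **The row `p = 18` at level `7` from `n = 192` on** (`d ≥ 174`; `HyperplaneKeySeven`: from `n = 244`, `d ≥ 226`). -/
theorem c025_core_seven_hyperplane_key_sharp_eighteen (M : Matroid α) [M.Finite] (hR : M.eRank = ((18 : ℕ) : ℕ∞))
    (hn : 192 ≤ M.E.ncard)
    (hfree : ∀ e ∈ M.E, ∃ A ⊆ M.E \ {e}, e ∉ M.closure A ∧ e ∉ M.closure ((M.E \ {e}) \ A)) :
    ThmN.RLS M 18 7 :=
  rls_of_hyperplane_key_two_base_weighted M 18 7 hR hfree (fun j : ℕ => if j = 0 then 1 else if j = 1 then 2 else if j = 2 then 4 else if j = 3 then 8 else if j = 4 then 32 else if j = 5 then 99 else if j = 6 then 387624 else 538123198718864) (ncard_eRk_le_seven_le_of_free_flats M hfree)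
    192 (by norm_num) hn
    (by rw [phiK_eighteen_seven]; simp only [Finset.sum_range_succ, Finset.sum_range_zero]; norm_num [Nat.choose_eq_factorial_div_factorial, Nat.factorial])
    (by rw [phiK_eighteen_seven]; simp only [Finset.sum_range_succ, Finset.sum_range_zero]; norm_num [Nat.choose_eq_factorial_div_factorial, Nat.factorial])

/-- **The row `p = 19` at level `7` from `n = 194` on** (`d ≥ 175`; `HyperplaneKeySeven`: from `n = 244`, `d ≥ 225`). -/
theorem c025_core_seven_hyperplane_key_sharp_nineteen (M : Matroid α) [M.Finite] (hR : M.eRank = ((19 : ℕ) : ℕ∞))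
    (hn : 194 ≤ M.E.ncard)
    (hfree : ∀ e ∈ M.E, ∃ A ⊆ M.E \ {e}, e ∉ M.closure A ∧ e ∉ M.closure ((M.E \ {e}) \ A)) :
    ThmN.RLS M 19 7 :=
  rls_of_hyperplane_key_two_base_weighted M 19 7 hR hfree (fun j : ℕ => if j = 0 then 1 else if j = 1 then 2 else if j = 2 then 4 else if j = 3 then 8 else if j = 4 then 32 else if j = 5 then 99 else if j = 6 then 387624 else 538123198718864) (ncard_eRk_le_seven_le_of_free_flats M hfree)
    194 (by norm_num) hn
    (by rw [phiK_nineteen_seven]; simp only [Finset.sum_range_succ, Finset.sum_range_zero]; norm_num [Nat.choose_eq_factorial_div_factorial, Nat.factorial])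
    (by rw [phiK_nineteen_seven]; simp only [Finset.sum_range_succ, Finset.sum_range_zero]; norm_num [Nat.choose_eq_factorial_div_factorial, Nat.factorial])

/-- **The row `p = 20` at level `7` from `n = 194` on** (`d ≥ 174`; `HyperplaneKeySeven`: from `n = 246`, `d ≥ 226`). -/
theorem c025_core_seven_hyperplane_key_sharp_twenty (M : Matroid α) [M.Finite] (hR : M.eRank = ((20 : ℕ) : ℕ∞))
    (hn : 194 ≤ M.E.ncard)
    (hfree : ∀ e ∈ M.E, ∃ A ⊆ M.E \ {e}, e ∉ M.closure A ∧ e ∉ M.closure ((M.E \ {e}) \ A)) :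
    ThmN.RLS M 20 7 :=
  rls_of_hyperplane_key_two_base_weighted M 20 7 hR hfree (fun j : ℕ => if j = 0 then 1 else if j = 1 then 2 else if j = 2 then 4 else if j = 3 then 8 else if j = 4 then 32 else if j = 5 then 99 else if j = 6 then 387624 else 538123198718864) (ncard_eRk_le_seven_le_of_free_flats M hfree)
    194 (by norm_num) hn
    (by rw [phiK_twenty_seven]; simp only [Finset.sum_range_succ, Finset.sum_range_zero]; norm_num [Nat.choose_eq_factorial_div_factorial, Nat.factorial])
    (by rw [phiK_twenty_seven]; simp only [Finset.sum_range_succ, Finset.sum_range_zero]; norm_num [Nat.choose_eq_factorial_div_factorial, Nat.factorial])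

/-- **The row `p = 21` at level `7` from `n = 196` on** (`d ≥ 175`; `HyperplaneKeySeven`: from `n = 248`, `d ≥ 227`). -/
theorem c025_core_seven_hyperplane_key_sharp_twentyone (M : Matroid α) [M.Finite] (hR : M.eRank = ((21 : ℕ) : ℕ∞))
    (hn : 196 ≤ M.E.ncard)
    (hfree : ∀ e ∈ M.E, ∃ A ⊆ M.E \ {e}, e ∉ M.closure A ∧ e ∉ M.closure ((M.E \ {e}) \ A)) :
    ThmN.RLS M 21 7 :=
  rls_of_hyperplane_key_two_base_weighted M 21 7 hR hfree (fun j : ℕ => if j = 0 then 1 else if j = 1 then 2 else if j = 2 then 4 else if j = 3 then 8 else if j = 4 then 32 else if j = 5 then 99 else if j = 6 then 387624 else 538123198718864) (ncard_eRk_le_seven_le_of_free_flats M hfree)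
    196 (by norm_num) hn
    (by rw [phiK_twentyone_seven]; simp only [Finset.sum_range_succ, Finset.sum_range_zero]; norm_num [Nat.choose_eq_factorial_div_factorial, Nat.factorial])
    (by rw [phiK_twentyone_seven]; simp only [Finset.sum_range_succ, Finset.sum_range_zero]; norm_num [Nat.choose_eq_factorial_div_factorial, Nat.factorial])

end HypKey

end PercRepro
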